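import Literature.NumberTheory.Automorphic.LangAutomorphicForms
import Literature.NumberTheory.Automorphic.AutomorphicRepsGLCuspFormsRapidDecayMW
import Literature.NumberTheory.Automorphic.AutomorphicRepsGLCuspFormsRapidDecayMWProofs
import Literature.NumberTheory.Automorphic.AutomorphicRepsGLUniformModerateGrowth
import Literature.NumberTheory.Automorphic.HarishChandraDiracGL
import Literature.NumberTheory.Automorphic.MinkowskiReductionGLn
import HarnessLib

/-!
# The named facts of `LangAutomorphicForms` (Borel–Jacquet 4.3 (i) and 4.4): proved reductions

Topic `NumberTheory/Automorphic`; sibling proof file of `LangAutomorphicForms`, which states, for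
`GL_n` over a number field `K`, Harish-Chandra's finiteness theorem `harishChandra_finiteness hcpt`
(Borel–Jacquet 1979, 4.3 (i); Harish-Chandra, LNM 62 (1968), Thm. 1; Getz–Hahn 2024, Thm. 6.1 for
the adelic phrasing: for a level `U`, an ideal `J ≤ Z(𝔤)` of finite codimension and a finite set of
`K_∞`-types — a finite-dimensional right-`K_∞`-stable space `M` of functions on `K_∞` containing
every slice `k ↦ φ (g k)` — the automorphic forms of level `U` annihilated by `J` with slices in
`M` span a finite-dimensional space) and the boundedness of cusp forms `cuspForm_bounded hcpt`
(Borel–Jacquet 1979, 4.4; Getz–Hahn 2024, Thm. 9.8.1 with the first sentence of the proof of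
Thm. 6.5.1) as named facts. This file PROVES:

* `harishChandra_finiteness_gl_of_harishChandra_finiteness` — **the ideal form of
  Harish-Chandra's finiteness theorem implies the character form** `harishChandra_finiteness_gl
  hcpt` of `AutomorphicRepsGL` (the same statement with `J = ker θ` for a `Z(𝔤)`-character `θ`,
  the hypothesis `hfin`/`hHC` of the cuspidal admissibility files): `ker θ` has finite
  codimension in `Z(𝔤)` (`Z(𝔤) ⧸ ker θ ↪ ℂ`, `Ideal.kerLiftAlg_injective`), and a form with
  `Z(𝔤)`-character `θ` is annihilated by every central word in `ker θ`; so discharging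
  `harishChandra_finiteness` discharges `harishChandra_finiteness_gl` as well.
* `IsCuspFormGL.bounded_of_isRapidlyDecreasingGL` and `cuspForm_bounded_of_isRapidlyDecreasingGL` —
  **a rapidly decreasing cusp form whose absolute value is invariant under the centre is bounded**,
  for one cusp form and, if every cusp form is rapidly decreasing, as `cuspForm_bounded`: by
  reduction theory (`reductionTheory_gl_holds`, Getz–Hahn Thm. 2.7.2)
  `g = γ z ω a k`; `‖φ‖` is invariant under `γ ∈ GL_n(K)` (left invariance) and under
  `z ∈ A_G ⊆ Z(𝔸_K)` (`posRealScalar_mem_center` and the hypothesis of `cuspForm_bounded`), the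
  conjugates `a⁻¹ ω a` stay in a compact set (`exists_isCompact_conj_siegelCone_mem_of_subset`), and
  rapid decrease bounds `φ` on `A_{T₀}(t) · (C K)` (`IsRapidlyDecreasingGL.exists_bound_siegelCone_mul`;
  for `n ≤ 1` the cone is `{1}` and continuity suffices) — the argument of
  `AutomorphicRepsGL.cuspidal_bounded_of_rapidlyDecreasing` (Getz–Hahn, proof of Thm. 6.5.1) with
  `‖φ (z g)‖ = ‖φ g‖` in place of `A_G`-invariance.
* `IsCuspFormGL.bounded_of_hasUniformModerateGrowth` — **a cusp form of uniformly moderate growth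
  whose absolute value is invariant under the centre is bounded** (unconditional: Moeglin–Waldspurger
  Cor. I.2.12 for `GL_n/K` in the cuspidal case is a theorem,
  `AutomorphicRepsGL.rapidlyDecreasingOnSiegelSets_of_cuspidal_of_rootShift` on MW Lemma I.2.10
  `AutomorphicRepsGL.siegelGrowthBound_rootShift_of_cuspCondition_holds` of
  `AutomorphicRepsGLCuspFormsRapidDecayMWProofs`; see also
  `AutomorphicRepsGL.rapidlyDecreasingOnSiegelSets_of_cuspidal_holds` and
  `IsCuspFormGL.isRapidlyDecreasingGL_of_hasUniformModerateGrowth` of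
  `AutomorphicRepsGLCuspFormsRapidDecaySiegelProofs`). This is `cuspForm_bounded` in
  Moeglin–Waldspurger's setting, where automorphic forms over a number field have uniformly
  moderate growth (I.2.17).
* `cuspForm_bounded_of_hasUniformModerateGrowth` — **`cuspForm_bounded` on the single remaining
  named fact of its cone**, uniformly moderate growth of automorphic forms
  `hasUniformModerateGrowth_of_isAutomorphicForm hcpt` (Moeglin–Waldspurger I.2.17); and
  `cuspForm_bounded_of_exists_convolution_eq_self` — the same on Harish-Chandra's convolution
  identity `exists_convolution_eq_self hcpt` (Harish-Chandra 1966, Thm. 1; Borel–Jacquet 4.3), which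
  gives MW I.2.17 (`hasUniformModerateGrowth_of_HC`).
* `cuspForm_bounded_of_siegel` — from the named facts `hasUniformModerateGrowth_of_isAutomorphicForm
  hcpt` (Moeglin–Waldspurger I.2.17) and `rapidlyDecreasingOnSiegelSets_of_cuspidal hcpt`
  (Moeglin–Waldspurger Cor. I.2.12), via `IsCuspFormGL.isRapidlyDecreasingGL` and the discharged
  Iwasawa decomposition `iwasawaDecomposition_gl_adelic_holds`.
* `cuspForm_bounded_of_HC` — the same with MW I.2.17 replaced by Harish-Chandra's convolution
  identity `exists_convolution_eq_self hcpt` (`hasUniformModerateGrowth_of_HC`).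
* `cuspForm_bounded_of_leaves` — the same on the two leaves of the tree at the time of p29406,
  `exists_finiteDimensional_convolution_mem hcpt` (Borel 1972, Thm. 3.17, via
  `exists_convolution_eq_self_of_finiteDimensional`) and
  `siegelGrowthBound_rootShift_of_cuspCondition hcpt` (Moeglin–Waldspurger Lemma I.2.10, via
  `rapidlyDecreasingOnSiegelSets_of_cuspidal_of_rootShift`; since discharged,
  `siegelGrowthBound_rootShift_of_cuspCondition_holds`).

The `cuspForm_bounded_of_siegel/_of_HC/_of_leaves` theorems restate, with the same names and
signatures, the glue theorems first landed in this file by proposal p29406 and removed by the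
concurrently created p29415 (both proposals created this file within seconds of each other); the
discharge `cuspForm_bounded_holds` waits on the one remaining leaf, Harish-Chandra's convolution
identity `AutomorphicRepsGL.exists_convolution_eq_self` (equivalently, for this purpose, MW I.2.17
`AutomorphicRepsGL.hasUniformModerateGrowth_of_isAutomorphicForm`): the definition of an automorphic
form (`IsAutomorphicForm`, Borel–Jacquet 4.2) asks moderate growth of `φ` only, while every printed
route to boundedness — MW's integration by parts along the unipotent radicals (I.2.10) as much as
Godement's estimate for `φ ∗ α` on a Siegel set — consumes growth bounds for the derivatives of `φ`
or the identity `φ = φ ∗ α`.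

What is NOT here: a proof of `harishChandra_finiteness` itself. Its printed proof
(Harish-Chandra 1968, §§2–4; Borel 1997, Thm. 8.5 for `SL₂(ℝ)`; Getz–Hahn 2024, Thm. 4.4.1 and
6.1) needs reduction theory (in the tree: `reductionTheory_gl_holds`), the passage from the adelic
quotient of level `U` to finitely many arithmetic quotients `Γᵢ \ GL_n(K_∞)`, Harish-Chandra's
convolution identity `φ = φ ∗ α` (tree: named fact `AutomorphicRepsGL.exists_convolution_eq_self`),
the constant terms along the standard parabolic subgroups with the induction on the Levi
subgroups (an ideal of finite codimension of `Z(𝔤)` gives one of `Z(𝔪)`; ordinary differential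
equations on the split component), and the finite-dimensionality of the cusp forms of type
`(J, σ)` (rapid decay — tree: named fact `AutomorphicRepsGL.cuspidal_rapidlyDecreasing` — plus
Godement's lemma on closed subspaces of `L²` consisting of bounded functions, or the compactness of
the convolution operators on `L²_cusp` — tree: named facts
`GLnCuspidalSpectrum.isDiscretelyDecomposable_cuspidal`, `multiplicity_cuspidal_lt_top`).

## References

* A. Borel, H. Jacquet, *Automorphic forms and automorphic representations*, Proc. Sympos. Pure
  Math. 33 (Corvallis 1977), part 1 (1979), 189–202, 4.3 (i), 4.4 [BorelJacquet1979].
* Harish-Chandra, *Automorphic forms on semisimple Lie groups*, LNM 62 (1968), Thm. 1.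
* A. Borel, *Automorphic forms on `SL₂(ℝ)`*, Cambridge Tracts in Math. 130 (1997), §8, Thm. 8.5
  (PDF pp. 63–66) [Borel1997].
* A. Borel, *Représentations de groupes localement compacts*, LNM 276 (1972), Thm. 3.17–3.18
  [Borel1972].
* J. R. Getz, H. Hahn, *An Introduction to Automorphic Representations*, GTM 300 (2024), Thm. 2.7.2,
  Thm. 6.1 (PDF pp. 134–135), Thm. 6.5.1 (proof), Thm. 9.8.1 [GetzHahn2024].
* C. Moeglin, J.-L. Waldspurger, *Spectral Decomposition and Eisenstein Series* (1995), I.2.10–I.2.12,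
  I.2.17 [MoeglinWaldspurger1995].
-/

open scoped MatrixGroups Matrix ContDiff Classical NNReal Pointwise
open NumberField NumberField.mixedEmbedding IsDedekindDomain

noncomputable section

namespace Literature.NumberTheory.Automorphic

variable {n : ℕ} {K : Type} [Field K] [NumberField K] {hcpt : isCompact_glFiniteIntegralLevel n K}

/-! ### Borel–Jacquet 4.3 (i): the ideal form implies the character form -/

/-- **The ideal form of Harish-Chandra's finiteness theorem implies the character form.** The
named fact `harishChandra_finiteness hcpt` (Borel–Jacquet 1979, 4.3 (i), as printed: the
automorphic forms of a fixed level annihilated by an ideal `J ≤ Z(𝔤)` of finite codimension and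
with `K_∞`-types in a fixed finite set span a finite-dimensional space) implies the sibling named
fact `harishChandra_finiteness_gl hcpt` of `AutomorphicRepsGL` (the same with `J = ker θ` for a
`Z(𝔤)`-character `θ : Z(𝔤) →ₐ[ℝ] ℂ`): `ker θ` has finite codimension because `Z(𝔤) ⧸ ker θ`
embeds `ℝ`-linearly into `ℂ` (`Ideal.kerLiftAlg_injective`), and a form with `Z(𝔤)`-character `θ`
(`HasZCharacter`: `z φ = θ(z) φ` for every central word `z`) is annihilated by every central word
whose image lies in `ker θ`; so the spanning set of the character form is contained in that of
the ideal form for `J = ker θ`. (Proved; it records that discharging `harishChandra_finiteness`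
also discharges `harishChandra_finiteness_gl`.) [cite: BorelJacquet1979, 4.3 (i)] -/
theorem harishChandra_finiteness_gl_of_harishChandra_finiteness
    (h : harishChandra_finiteness hcpt) : harishChandra_finiteness_gl hcpt := by
  intro U hU θ M _ hM
  haveI : FiniteDimensional ℝ (centerU (archGroupGL n K) ⧸ RingHom.ker θ) :=
    FiniteDimensional.of_injective (Ideal.kerLiftAlg θ).toLinearMap (Ideal.kerLiftAlg_injective θ)
  have hfin := h hU (RingHom.ker θ) M hM
  refine @Submodule.finiteDimensional_of_le ℂ _ _ _ _ _ _ hfin (Submodule.span_mono ?_)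
  rintro φ ⟨hφ, hUφ, hθ, hMφ⟩
  refine ⟨hφ, hUφ, fun p hp hpJ ↦ ?_, hMφ⟩
  rw [hθ p hp]
  show θ ⟨freeToEnveloping (archGroupGL n K) p, hp⟩ • φ = 0
  rw [RingHom.mem_ker.mp hpJ, zero_smul]

/-! ### Borel–Jacquet 4.4: boundedness of cusp forms from rapid decrease -/

/-- **A rapidly decreasing cusp form whose absolute value is invariant under the centre is
bounded.** If the cusp form `φ` on `GL_n(𝔸_K)` (`IsCuspFormGL`, Borel–Jacquet 4.4) is rapidly
decreasing in the sense of Getz–Hahn's Def. 9.3 (`IsRapidlyDecreasingGL`) and `‖φ (z g)‖ = ‖φ g‖`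
for all `z` in the centre `Z(𝔸_K)` (e.g. `φ` has a unitary central character), then `φ` is
bounded: by reduction theory (`reductionTheory_gl_holds`, Getz–Hahn Thm. 2.7.2)
`g = γ z ω a k` with `γ ∈ GL_n(K)`, `z ∈ A_G`, `ω ∈ Ω` relatively compact in `B(𝔸_K)`,
`a ∈ A_{T₀}(t)`, `k ∈ K`; `‖φ g‖ = ‖φ (ω a k)‖ = ‖φ (a · (a⁻¹ ω a) k)‖` by left invariance and
`A_G ⊆ Z(𝔸_K)` (`posRealScalar_mem_center`); the elements `(a⁻¹ ω a) k` lie in a compact set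
`C · K` (`exists_isCompact_conj_siegelCone_mem_of_subset`, `isCompact_standardMaximalCompactGL`), on
`A_{T₀}(t) · (C K)` rapid decrease bounds `φ` for `n ≥ 2`
(`IsRapidlyDecreasingGL.exists_bound_siegelCone_mul`), and for `n ≤ 1` the cone is `{1}`
(`eq_one_of_mem_siegelCone`) and the continuous `φ` is bounded on the compact `C K` (the argument
of `AutomorphicRepsGL.cuspidal_bounded_of_rapidlyDecreasing`, Getz–Hahn 2024, proof of Thm. 6.5.1,
first sentence, with `‖φ (z g)‖ = ‖φ g‖` in place of `A_G`-invariance). [cite: BorelJacquet1979, 4.4] -/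
theorem IsCuspFormGL.bounded_of_isRapidlyDecreasingGL
    {φ : (AdelicGroupData.gl n K).Adelic → ℂ} (hφ : IsCuspFormGL n K hcpt φ)
    (hrd : IsRapidlyDecreasingGL n K φ)
    (hZ : ∀ z ∈ Subgroup.center (AdelicGroupData.gl n K).Adelic, ∀ g, ‖φ (z * g)‖ = ‖φ g‖) :
    ∃ C : ℝ, ∀ g : (AdelicGroupData.gl n K).Adelic, ‖φ g‖ ≤ C := by
  have hφ𝒜 : φ ∈ automorphicForms (AutomorphyDatum.gl n K hcpt) :=
    IsAutomorphicForm.mem_automorphicForms _ hφ.1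
  have hleft : ∀ γ ∈ rationalPointsGL n K, ∀ g : GL (Fin n) (AdeleRing (𝓞 K) K),
      φ (γ * g) = φ g :=
    fun γ hγ g => isLeftInvariant_of_mem_automorphicForms hφ𝒜 γ hγ g
  have hZ' : ∀ z ∈ (posRealScalar n K).range, ∀ g : GL (Fin n) (AdeleRing (𝓞 K) K),
      ‖φ (z * g)‖ = ‖φ g‖ := by
    rintro _ ⟨t, rfl⟩ g
    exact hZ _ (posRealScalar_mem_center n K t) g
  have hcont : Continuous φ := continuous_of_mem_automorphicForms_gl hφ𝒜
  -- reduction theory: `g = γ z ω a k`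
  obtain ⟨Ω, t, ht, hΩNM, hΩc, hdec⟩ := (reductionTheory_gl_holds n K).exists_mul_eq
  haveI : T2Space (AdeleRing (𝓞 K) K) := by
    haveI : T2Space (FiniteAdeleRing (𝓞 K) K) := inferInstanceAs <| T2Space
      (RestrictedProduct (fun w : HeightOneSpectrum (𝓞 K) => w.adicCompletion K)
        (fun w => (w.adicCompletionIntegers K : Set (w.adicCompletion K))) Filter.cofinite)
    haveI : T2Space (InfiniteAdeleRing K) :=
      inferInstanceAs <| T2Space ((w : InfinitePlace K) → w.Completion)
    exact inferInstanceAs <| T2Space (InfiniteAdeleRing K × FiniteAdeleRing (𝓞 K) K)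
  have hΩB : closure Ω ⊆ (standardParabolicGL (AdeleRing (𝓞 K) K) (id : Fin n → Fin n) :
      Set (GL (Fin n) (AdeleRing (𝓞 K) K))) :=
    (isClosed_standardParabolicGL_id.closure_subset_iff).2
      (hΩNM.trans upperUnitriangular_mul_normOneDiagonal_subset)
  -- a compact set absorbing the conjugates `a⁻¹ ω a`
  obtain ⟨C, hCc, hC⟩ := exists_isCompact_conj_siegelCone_mem_of_subset ht hΩB hΩc
  have hCKc : IsCompact (C * (standardMaximalCompactGL n K :
      Set (GL (Fin n) (AdeleRing (𝓞 K) K)))) :=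
    hCc.mul (isCompact_standardMaximalCompactGL n K)
  -- every value of `‖φ‖` is a value on `A_{T₀}(t) · (C K)`
  have key : ∀ g : GL (Fin n) (AdeleRing (𝓞 K) K), ∃ a ∈ siegelCone n K t,
      ∃ y ∈ C * (standardMaximalCompactGL n K : Set (GL (Fin n) (AdeleRing (𝓞 K) K))),
        ‖φ g‖ = ‖φ (a * y)‖ := by
    intro g
    obtain ⟨γ, hγ, z, hz, w, hw, a, ha, k, hk, hg⟩ := hdec g
    refine ⟨a, ha, a⁻¹ * w * a * k, Set.mul_mem_mul (hC a ha w (subset_closure hw)) hk, ?_⟩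
    rw [← hg]
    calc ‖φ (γ * z * w * a * k)‖ = ‖φ (γ * (z * (w * a * k)))‖ := by simp only [mul_assoc]
      _ = ‖φ (w * a * k)‖ := by rw [hleft γ hγ, hZ' z hz]
      _ = ‖φ (a * (a⁻¹ * w * a * k))‖ := by
          congr 2
          simp only [mul_assoc, mul_inv_cancel_left]
  -- uniform bound on `A_{T₀}(t) · (C K)`
  obtain ⟨B, hB⟩ : ∃ B : ℝ, ∀ a ∈ siegelCone n K t,
      ∀ y ∈ C * (standardMaximalCompactGL n K : Set (GL (Fin n) (AdeleRing (𝓞 K) K))),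
        ‖φ (a * y)‖ ≤ B := by
    rcases Nat.lt_or_ge 1 n with hn | hn
    · exact hrd.exists_bound_siegelCone_mul hn hCKc ht
    · obtain ⟨B, hB⟩ := hCKc.exists_bound_of_continuousOn hcont.continuousOn
      refine ⟨B, fun a ha y hy => ?_⟩
      rw [eq_one_of_mem_siegelCone hn ha, one_mul]
      exact hB y hy
  refine ⟨B, fun g => ?_⟩
  obtain ⟨a, ha, y, hy, hg⟩ := key g
  rw [hg]
  exact hB a ha y hy

/-- **Rapid decrease of every cusp form implies `cuspForm_bounded`.** If every cusp form on
`GL_n(𝔸_K)` (`IsCuspFormGL`, Borel–Jacquet 4.4) is rapidly decreasing in the sense of Getz–Hahn's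
Def. 9.3 (`IsRapidlyDecreasingGL`), then every cusp form whose absolute value is invariant under the
centre `Z(𝔸_K)` is bounded (`IsCuspFormGL.bounded_of_isRapidlyDecreasingGL` for each cusp form).
[cite: BorelJacquet1979, 4.4] -/
theorem cuspForm_bounded_of_isRapidlyDecreasingGL
    (hrd : ∀ φ : (AdelicGroupData.gl n K).Adelic → ℂ, IsCuspFormGL n K hcpt φ →
      IsRapidlyDecreasingGL n K φ) :
    cuspForm_bounded hcpt := by
  intro φ hφ hZ
  exact hφ.bounded_of_isRapidlyDecreasingGL (hrd φ hφ) hZ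

/-! ### Borel–Jacquet 4.4 in Moeglin–Waldspurger's setting: uniformly moderate growth suffices -/

/-- **A cusp form of uniformly moderate growth whose absolute value is invariant under the centre
is bounded** (Borel–Jacquet 1979, 4.4: a cusp form with unitary central character is bounded — here
for cusp forms which, with their derivatives, have uniformly moderate growth, as all automorphic
forms over a number field do by Moeglin–Waldspurger I.2.17): if `φ` is a cusp form on `GL_n(𝔸_K)`
(`IsCuspFormGL`), `φ` has uniformly moderate growth (`HasUniformModerateGrowth`, MW I.2.3) and
`‖φ (z g)‖ = ‖φ g‖` for all `z ∈ Z(𝔸_K)`, then `‖φ‖ ≤ C`. Unconditional: `φ` is rapidly decreasing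
on Siegel sets by Moeglin–Waldspurger's Cor. I.2.12, which for `GL_n/K` in the cuspidal case is a
theorem (`AutomorphicRepsGL.rapidlyDecreasingOnSiegelSets_of_cuspidal_of_rootShift` on MW Lemma I.2.10
`AutomorphicRepsGL.siegelGrowthBound_rootShift_of_cuspCondition_holds`; recorded as
`AutomorphicRepsGL.rapidlyDecreasingOnSiegelSets_of_cuspidal_holds` and, for one cusp form, as
`IsCuspFormGL.isRapidlyDecreasingGL_of_hasUniformModerateGrowth` in
`AutomorphicRepsGLCuspFormsRapidDecaySiegelProofs`), hence rapidly decreasing in Getz–Hahn's sense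
(`IsRapidlyDecreasingOnSiegelSetsGL.isRapidlyDecreasingGL` with `iwasawaDecomposition_gl_adelic_holds`),
and `IsCuspFormGL.bounded_of_isRapidlyDecreasingGL` applies. [cite: BorelJacquet1979, 4.4] -/
theorem IsCuspFormGL.bounded_of_hasUniformModerateGrowth
    {φ : (AdelicGroupData.gl n K).Adelic → ℂ} (hφ : IsCuspFormGL n K hcpt φ)
    (hU : HasUniformModerateGrowth (AutomorphyDatum.gl n K hcpt) φ)
    (hZ : ∀ z ∈ Subgroup.center (AdelicGroupData.gl n K).Adelic, ∀ g, ‖φ (z * g)‖ = ‖φ g‖) :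
    ∃ C : ℝ, ∀ g : (AdelicGroupData.gl n K).Adelic, ‖φ g‖ ≤ C :=
  hφ.bounded_of_isRapidlyDecreasingGL
    (((AutomorphicRepsGL.rapidlyDecreasingOnSiegelSets_of_cuspidal_of_rootShift
      (AutomorphicRepsGL.siegelGrowthBound_rootShift_of_cuspCondition_holds hcpt)) φ
      hφ.1.leftInvariant hφ.1.archSmooth hφ.1.exists_level hφ.1.kFinite hU
      hφ.2).isRapidlyDecreasingGL hφ.1.leftInvariant (iwasawaDecomposition_gl_adelic_holds n K)) hZ

/-- **`cuspForm_bounded` on the single remaining named fact of its cone**: uniformly moderate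
growth of automorphic forms on `GL_n(𝔸_K)` (`hasUniformModerateGrowth_of_isAutomorphicForm hcpt`,
Moeglin–Waldspurger I.2.17) implies `cuspForm_bounded hcpt`
(`IsCuspFormGL.bounded_of_hasUniformModerateGrowth` for each cusp form). [cite: BorelJacquet1979, 4.4] -/
theorem cuspForm_bounded_of_hasUniformModerateGrowth
    (hU : AutomorphicRepsGL.hasUniformModerateGrowth_of_isAutomorphicForm hcpt) :
    cuspForm_bounded hcpt := by
  intro φ hφ hZ
  exact hφ.bounded_of_hasUniformModerateGrowth (hU φ hφ.1) hZ

/-- **`cuspForm_bounded` on Harish-Chandra's convolution identity alone**: granted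
`exists_convolution_eq_self hcpt` (`φ(g) = ∫ φ(g x) α(x) dx` for a test function `α` on
`GL_n(K_∞)`; Harish-Chandra 1966, Thm. 1; Borel–Jacquet 1979, 4.3), automorphic forms have
uniformly moderate growth (`hasUniformModerateGrowth_of_HC`, MW I.2.17) and
`cuspForm_bounded_of_hasUniformModerateGrowth` applies. [cite: BorelJacquet1979, 4.4] -/
theorem cuspForm_bounded_of_exists_convolution_eq_self
    (hHC : AutomorphicRepsGL.exists_convolution_eq_self hcpt) : cuspForm_bounded hcpt :=
  cuspForm_bounded_of_hasUniformModerateGrowth (AutomorphicRepsGL.hasUniformModerateGrowth_of_HC hHC)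

/-- **`cuspForm_bounded` on Harish-Chandra's admissibility input alone**: the named fact
`exists_finiteDimensional_convolution_mem hcpt` (Borel 1972, Thm. 3.17) gives the convolution
identity (`exists_convolution_eq_self_of_finiteDimensional`, Borel 1972, proof of Thm. 3.18), and
`cuspForm_bounded_of_exists_convolution_eq_self` applies. [cite: BorelJacquet1979, 4.4] -/
theorem cuspForm_bounded_of_exists_finiteDimensional_convolution_mem
    (hFD : AutomorphicRepsGL.exists_finiteDimensional_convolution_mem hcpt) : cuspForm_bounded hcpt :=
  cuspForm_bounded_of_exists_convolution_eq_self
    (AutomorphicRepsGL.exists_convolution_eq_self_of_finiteDimensional hFD)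

/-! ### The earlier two-hypothesis reductions (p29406) -/

/-- **`cuspForm_bounded` from the two Moeglin–Waldspurger facts**: uniformly moderate growth of
automorphic forms (`AutomorphicRepsGL.hasUniformModerateGrowth_of_isAutomorphicForm hcpt`, MW I.2.17)
and rapid decrease on Siegel sets of cuspidal functions of uniformly moderate growth
(`AutomorphicRepsGL.rapidlyDecreasingOnSiegelSets_of_cuspidal hcpt`, MW Cor. I.2.12) make every
cusp form rapidly decreasing (`IsCuspFormGL.isRapidlyDecreasingGL`, with the discharged Iwasawa
decomposition `iwasawaDecomposition_gl_adelic_holds`), whence `cuspForm_bounded hcpt` by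
`cuspForm_bounded_of_isRapidlyDecreasingGL`. [cite: BorelJacquet1979, 4.4] -/
theorem cuspForm_bounded_of_siegel
    (hU : AutomorphicRepsGL.hasUniformModerateGrowth_of_isAutomorphicForm hcpt)
    (hS : AutomorphicRepsGL.rapidlyDecreasingOnSiegelSets_of_cuspidal hcpt) :
    cuspForm_bounded hcpt :=
  cuspForm_bounded_of_isRapidlyDecreasingGL fun _ hφ =>
    IsCuspFormGL.isRapidlyDecreasingGL hU hS (iwasawaDecomposition_gl_adelic_holds n K) hφ

/-- **`cuspForm_bounded` from Harish-Chandra's convolution identity and MW Cor. I.2.12**: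
`AutomorphicRepsGL.exists_convolution_eq_self hcpt` gives uniformly moderate growth
(`AutomorphicRepsGL.hasUniformModerateGrowth_of_HC`, MW I.2.17), and `cuspForm_bounded_of_siegel`
applies. [cite: BorelJacquet1979, 4.4] -/
theorem cuspForm_bounded_of_HC
    (hHC : AutomorphicRepsGL.exists_convolution_eq_self hcpt)
    (hS : AutomorphicRepsGL.rapidlyDecreasingOnSiegelSets_of_cuspidal hcpt) :
    cuspForm_bounded hcpt :=
  cuspForm_bounded_of_siegel (AutomorphicRepsGL.hasUniformModerateGrowth_of_HC hHC) hS

/-- **`cuspForm_bounded` on the two current leaves of the tree**: Harish-Chandra's admissibility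
input `AutomorphicRepsGL.exists_finiteDimensional_convolution_mem hcpt` (Borel 1972, Thm. 3.17;
it gives the convolution identity, `exists_convolution_eq_self_of_finiteDimensional`) and
Moeglin–Waldspurger's Lemma I.2.10 `AutomorphicRepsGL.siegelGrowthBound_rootShift_of_cuspCondition
hcpt` (it gives MW Cor. I.2.12, `rapidlyDecreasingOnSiegelSets_of_cuspidal_of_rootShift`) imply
`cuspForm_bounded hcpt` (`cuspForm_bounded_of_HC`). [cite: BorelJacquet1979, 4.4] -/
theorem cuspForm_bounded_of_leaves
    (hFD : AutomorphicRepsGL.exists_finiteDimensional_convolution_mem hcpt)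
    (h410 : AutomorphicRepsGL.siegelGrowthBound_rootShift_of_cuspCondition hcpt) :
    cuspForm_bounded hcpt :=
  cuspForm_bounded_of_HC (AutomorphicRepsGL.exists_convolution_eq_self_of_finiteDimensional hFD)
    (AutomorphicRepsGL.rapidlyDecreasingOnSiegelSets_of_cuspidal_of_rootShift h410)

end Literature.NumberTheory.Automorphic
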